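import Literature.Computability.Cryptography.PeriodFindingIndependence
import Literature.Computability.Cryptography.PeriodFindingUnits
import Literature.NumberTheory.Sieve.CoprimePairsDensity
import HarnessLib

/-!
# Period finding with an irrational period: one character per unit, and two coprime samples

Topic `Computability/Cryptography`; continues `PeriodFindingUnits.lean` and
`PeriodFindingIndependence.lean`. The analysis of Hallgren's period finding in the tree's family
(Jozsa 2003, §10: a Fourier sample `c ≈ kq/S` for a random harmonic `k`, two samples with coprime
`k₁, k₂`) reads, per unit, Kitaev's exact character estimate `cEst` (`PeriodFindingAccuracy.lean`).
Generic bounds (any tables `F`):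

* **`unitLaw_cEst_ge`** — for every character `c`, `P(cEst_u = c) ≥ (1 − ηacc) · unitWeight_u (c)`
  (accurate read-outs recover `c` exactly, `cEst_eq_of_accurate`; accuracy `sum_accurateU_ge`);
* **`prob_twoSamples_ge`** — for distinct units `u ≠ u'` and target characters `ck k`, `ck' k'`
  (`k, k' ∈ [1, K]`, injective in the harmonic index), if `P(cEst_u = ck k) ≥ q` and
  `P(cEst_{u'} = ck' k') ≥ q'` for all `k, k'`, then the probability that the two estimates are the
  targets of a COPRIME pair `(k, k')` is `≥ (K²/2) · q q'` (independence of distinct units,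
  additivity over the disjoint target pairs, and `#{coprime pairs in [1,K]²} ≥ K²/2`,
  `Sieve/CoprimePairsDensity.lean`).

Theorem file, no named facts.

## References

* R. Jozsa, arXiv:quant-ph/0302134 (2003), §10 (Thm. 6, Lemma 2, "if k₁ and k₂ are coprime").
  [Jozsa2003]
* A. Yu. Kitaev, arXiv:quant-ph/9511026 (1995), §3 (Lemma 10, Thm. 1). [Kitaev1995]
-/

noncomputable section

namespace Literature.Computability.Cryptography

namespace PeriodFinding

open _root_.Computability Complexity QuantumComplexity Matrix Finset Kitaev1995

section OneSample

variable {U : Type*} {Ω : Type*} [DecidableEq Ω] {Lv B : ℕ}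

/-- **One character per unit**: the probability that Kitaev's estimate of unit `u` is the character
`c` is at least `(1 − ηacc) · unitWeight_u (c)`. [cite: Kitaev1995, §3 Lemma 10 and Thm. 1] -/
theorem unitLaw_cEst_ge (Lu : U → ℕ) (F : U → ℕ → Ω) (hB : 0 < B) (hLv : 0 < Lv) {u : U}
    (hQLv : Qof Lu u ≤ 2 ^ (Lv - 1)) (c : Fin (Qof Lu u)) :
    (1 - ηacc Lv B) * unitWeight Lu F u c ≤
      ∑ γu ∈ univ.filter (fun γu : TIdx Lv B → Bool => cEst (Qof Lu u) γu = c), unitLaw Lu F u γu := by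
  classical
  rw [sum_unitLaw_filter]
  have hacc : 1 - ηacc Lv B ≤ ∑ γu ∈ univ.filter (fun γu : TIdx Lv B → Bool => cEst (Qof Lu u) γu = c),
      trialWeight (Qof Lu u) c γu := by
    refine (sum_accurateU_ge hB (Qof Lu u) c).trans
      (sum_le_sum_of_subset_of_nonneg (fun γu hγu => ?_) fun γu _ _ => trialWeight_nonneg _ _ γu)
    refine mem_filter.2 ⟨mem_univ _, ?_⟩
    exact cEst_eq_of_accurate hB hLv hQLv c.isLt (mem_filter.1 hγu).2
  have hnonneg : ∀ c' : Fin (Qof Lu u), 0 ≤ unitWeight Lu F u c' *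
      ∑ γu ∈ univ.filter (fun γu : TIdx Lv B → Bool => cEst (Qof Lu u) γu = c),
        trialWeight (Qof Lu u) c' γu := fun c' =>
    mul_nonneg (unitWeight_nonneg Lu F u c') (sum_nonneg fun γu _ => trialWeight_nonneg _ _ γu)
  calc (1 - ηacc Lv B) * unitWeight Lu F u c
      ≤ unitWeight Lu F u c * ∑ γu ∈ univ.filter (fun γu : TIdx Lv B → Bool => cEst (Qof Lu u) γu = c),
          trialWeight (Qof Lu u) c γu := by
        rw [mul_comm]
        exact mul_le_mul_of_nonneg_left hacc (unitWeight_nonneg Lu F u c)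
    _ = ∑ c' ∈ ({c} : Finset (Fin (Qof Lu u))), unitWeight Lu F u c' *
          ∑ γu ∈ univ.filter (fun γu : TIdx Lv B → Bool => cEst (Qof Lu u) γu = c),
            trialWeight (Qof Lu u) c' γu := by rw [sum_singleton]
    _ ≤ ∑ c' : Fin (Qof Lu u), unitWeight Lu F u c' *
          ∑ γu ∈ univ.filter (fun γu : TIdx Lv B → Bool => cEst (Qof Lu u) γu = c),
            trialWeight (Qof Lu u) c' γu :=
        sum_le_sum_of_subset_of_nonneg (subset_univ _) fun c' _ _ => hnonneg c'

/-- The same in the vocabulary `prob` of product laws: `P(cEst_u = c) ≥ (1 − ηacc) unitWeight_u(c)`.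
[cite: Kitaev1995, §3] -/
theorem prob_cEst_ge [Fintype U] [DecidableEq U] (Lu : U → ℕ) (F : U → ℕ → Ω) (hB : 0 < B) (hLv : 0 < Lv)
    {u : U} (hQLv : Qof Lu u ≤ 2 ^ (Lv - 1)) (c : Fin (Qof Lu u)) :
    (1 - ηacc Lv B) * unitWeight Lu F u c ≤
      prob (X := fun _ : U => TIdx Lv B → Bool) (unitLaw Lu F)
        (univ.filter fun γ => cEst (Qof Lu u) (γ u) = c) := by
  classical
  have h := prob_filter_apply (X := fun _ : U => TIdx Lv B → Bool) (unitLaw_isProbVec Lu F) u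
    (univ.filter fun γu : TIdx Lv B → Bool => cEst (Qof Lu u) γu = c)
  have hE : (univ.filter fun γ : U → TIdx Lv B → Bool => γ u ∈ univ.filter fun γu : TIdx Lv B → Bool =>
      cEst (Qof Lu u) γu = c) = univ.filter fun γ => cEst (Qof Lu u) (γ u) = c := by
    ext γ; simp
  rw [hE] at h
  rw [h]
  exact unitLaw_cEst_ge Lu F hB hLv hQLv c

end OneSample

/-! ### Two coprime samples -/

section TwoSamples

variable {U : Type*} [Fintype U] [DecidableEq U] {Ω : Type*} [DecidableEq Ω] {Lv B : ℕ}

open Literature.NumberTheory.Sieve.CoprimePairs in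
/-- **Two coprime samples from two units.** For distinct units `u ≠ u'` with target characters
`ck k` (unit `u`) and `ck' k'` (unit `u'`) for the harmonics `k, k' ∈ [1, K]`, injective in the
harmonic, each hit with probability `≥ q` resp. `≥ q'`: the estimates are the targets of a coprime
pair of harmonics with probability `≥ (K²/2) q q'`. [cite: Jozsa2003, §10 (two runs, k₁ and k₂ coprime with constant probability)] -/
theorem prob_twoSamples_ge (Lu : U → ℕ) (F : U → ℕ → Ω) {u u' : U} (huu : u ≠ u') (K : ℕ)
    (ck ck' : ℕ → ℕ) (hinj : Set.InjOn ck (Icc 1 K : Finset ℕ)) (hinj' : Set.InjOn ck' (Icc 1 K : Finset ℕ))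
    {q q' : ℝ} (hq0 : 0 ≤ q) (hq'0 : 0 ≤ q')
    (hq : ∀ k ∈ Icc 1 K, q ≤ prob (X := fun _ : U => TIdx Lv B → Bool) (unitLaw Lu F)
      (univ.filter fun γ => cEst (Qof Lu u) (γ u) = ck k))
    (hq' : ∀ k' ∈ Icc 1 K, q' ≤ prob (X := fun _ : U => TIdx Lv B → Bool) (unitLaw Lu F)
      (univ.filter fun γ => cEst (Qof Lu u') (γ u') = ck' k')) :
    ((K : ℝ) ^ 2 / 2) * (q * q') ≤
      prob (X := fun _ : U => TIdx Lv B → Bool) (unitLaw Lu F)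
        (univ.filter fun γ => ∃ kk ∈ ((Icc 1 K) ×ˢ (Icc 1 K)).filter (fun kl : ℕ × ℕ => Nat.Coprime kl.1 kl.2),
          cEst (Qof Lu u) (γ u) = ck kk.1 ∧ cEst (Qof Lu u') (γ u') = ck' kk.2) := by
  classical
  set C := ((Icc 1 K) ×ˢ (Icc 1 K)).filter (fun kl : ℕ × ℕ => Nat.Coprime kl.1 kl.2) with hC
  have hμ := unitLaw_isProbVec (Lv := Lv) (B := B) Lu F
  -- additivity over the (disjoint) target pairs
  have hadd := prob_exists_disjoint_eq_sum (X := fun _ : U => TIdx Lv B → Bool) (μ := unitLaw Lu F) C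
    (fun kk (γ : U → TIdx Lv B → Bool) => cEst (Qof Lu u) (γ u) = ck kk.1 ∧ cEst (Qof Lu u') (γ u') = ck' kk.2) ?_
  · rw [hadd]
    -- each pair: independence, then the per-unit bounds
    have hterm : ∀ kk ∈ C, q * q' ≤ prob (X := fun _ : U => TIdx Lv B → Bool) (unitLaw Lu F)
        (univ.filter fun γ => cEst (Qof Lu u) (γ u) = ck kk.1 ∧ cEst (Qof Lu u') (γ u') = ck' kk.2) := by
      intro kk hkk
      obtain ⟨hmem, -⟩ := mem_filter.1 hkk
      obtain ⟨h1, h2⟩ := mem_product.1 hmem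
      have hind := prob_pair_eq_mul (X := fun _ : U => TIdx Lv B → Bool) hμ huu
        (univ.filter fun x : TIdx Lv B → Bool => cEst (Qof Lu u) x = ck kk.1)
        (univ.filter fun x : TIdx Lv B → Bool => cEst (Qof Lu u') x = ck' kk.2)
      simp only [mem_filter, mem_univ, true_and] at hind
      rw [hind]
      exact mul_le_mul (hq _ h1) (hq' _ h2) hq'0 ((hq0.trans (hq _ h1)))
    calc ((K : ℝ) ^ 2 / 2) * (q * q') ≤ (C.card : ℝ) * (q * q') :=
          mul_le_mul_of_nonneg_right (card_coprime_pairs_ge K) (mul_nonneg hq0 hq'0)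
      _ = ∑ _kk ∈ C, q * q' := by rw [sum_const, nsmul_eq_mul]
      _ ≤ _ := sum_le_sum hterm
  · -- disjointness: distinct pairs have distinct targets
    rintro kk hkk kk' hkk' hne γ ⟨⟨ha, hb⟩, ⟨ha', hb'⟩⟩
    obtain ⟨hmem, -⟩ := mem_filter.1 hkk
    obtain ⟨hmem', -⟩ := mem_filter.1 hkk'
    obtain ⟨h1, h2⟩ := mem_product.1 hmem
    obtain ⟨h1', h2'⟩ := mem_product.1 hmem'
    apply hne
    have e1 : kk.1 = kk'.1 := hinj h1 h1' (ha.symm.trans ha')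
    have e2 : kk.2 = kk'.2 := hinj' h2 h2' (hb.symm.trans hb')
    exact Prod.ext e1 e2

end TwoSamples

end PeriodFinding

end Literature.Computability.Cryptography

end
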